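import Summits.BirchSwinnertonDyer.BirchSwinnertonDyer.Theorems.EisensteinDepletionAtTwoStarGO2CuspEvennessParabolic
import HarnessLib

/-!
# Cusp-evenness, part 2: (E-LEG) the 2-adic size of the cusp sums, and the parabolic normal form

Part of the cusp-evenness package for line `kummer` of crux `StarGO2Sigma` (stmt-BirchSwinnertonDyer-27046), written by
planner bsd-rank2-p2 GEN 36 (HOME/p2/g36/lean/CuspEvenness.lean, `lean check` rc 0, 0 sorries; memo HOME/p2/g36/CUSP-EVENNESS.md;
numerics kit j312110) and landed verbatim, split into four files for the 400-line rule, by the lead star-p1 GEN 11.  The full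
mathematical overview is the module docstring of `EisensteinDepletionAtTwoStarGO2CuspEvennessParabolic.lean` (part 1).  This part: §3 `norm_cuspSum_le` (‖S(n)‖₂ ≤ 2⁻⁴ off the levels ℓ², ℓ ≡ ±3 (8)) and §4 `exists_eq_conj_T_zpow_of_trace_eq_two`.
BSD is not proved by this file; nothing here reads `r_an`.
-/


set_option linter.dupNamespace false
set_option autoImplicit false

open scoped MatrixGroups
open CongruenceSubgroup Matrix.SpecialLinearGroup

namespace Summit.BirchSwinnertonDyer.BirchSwinnertonDyer.Theorems.DepletionAtTwo.CuspEvenness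

open Literature.NumberTheory.ModularForms

/-! ### §3 (E-LEG) The cusp sums `S(n) = ∑_{t ∣ N} c_t·gcd(t,n)²/t` are `≡ 0 (mod 16)` in `ℤ₂` off the levels `ℓ²`, `ℓ ≡ ±3 (8)` -/

section ELeg

variable {N : ℕ} {β : ℕ → ℕ}

/-- The weight `t ↦ gcd(t, n)²/t` is multiplicative on coprime arguments. [folklore] -/
theorem gcd_sq_div_mul (n : ℕ) {m m' : ℕ} (h : Nat.Coprime m m') :
    (((m * m').gcd n : ℕ) : ℚ) ^ 2 / ((m * m' : ℕ) : ℚ) = ((m.gcd n : ℕ) : ℚ) ^ 2 / m * (((m'.gcd n : ℕ) : ℚ) ^ 2 / m') := by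
  have hg : (m * m').gcd n = m.gcd n * m'.gcd n := by
    rw [Nat.gcd_comm, Nat.Coprime.gcd_mul n h, Nat.gcd_comm n m, Nat.gcd_comm n m']
  rw [hg]
  push_cast
  ring

/-- `S(n)` as an Euler product over the primes of `N`. [cite: Stevens1982, §2.4 (PDF pp. 35–37)] -/
theorem cuspSum_eq_prod (hN : N ≠ 0) (n : ℕ) :
    ∑ t ∈ N.divisors, stabCoeff N β t * ((t.gcd n : ℕ) : ℚ) ^ 2 / t =
      ∏ ℓ ∈ N.primeFactors, ∑ j ∈ Finset.range (N.factorization ℓ + 1),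
        localStabCoeff N β ℓ j * ((((ℓ ^ j).gcd n : ℕ) : ℚ) ^ 2 / ((ℓ ^ j : ℕ) : ℚ)) := by
  have h := sum_divisors_stabCoeff_mul N β (R := ℚ) (fun t ↦ ((t.gcd n : ℕ) : ℚ) ^ 2 / t) (by simp)
    (fun m m' _ _ hc ↦ gcd_sq_div_mul n hc) hN
  simp only [Algebra.algebraMap_self, RingHom.id_apply] at h
  simp only [mul_div_assoc]
  rw [h]
  refine Finset.prod_congr rfl fun ℓ hℓ ↦ Finset.sum_congr rfl fun j _ ↦ ?_
  rw [stabCoeff_prime_pow N β hℓ]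

/-- `gcd(ℓ², n) = ℓ` when `ℓ ∥ n`. [folklore] -/
theorem gcd_sq_eq_of_dvd_not_dvd {ℓ n : ℕ} (hp : ℓ.Prime) (h1 : ℓ ∣ n) (h2 : ¬ ℓ ^ 2 ∣ n) : (ℓ ^ 2).gcd n = ℓ := by
  obtain ⟨i, hi, he⟩ := (Nat.dvd_prime_pow hp).mp (Nat.gcd_dvd_left (ℓ ^ 2) n)
  have hℓd : ℓ ∣ (ℓ ^ 2).gcd n := Nat.dvd_gcd (dvd_pow_self ℓ two_ne_zero) h1
  interval_cases i
  · rw [he, pow_zero] at hℓd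
    exact absurd (Nat.eq_one_of_dvd_one hℓd) hp.one_lt.ne'
  · rw [he, pow_one]
  · exact absurd (he ▸ Nat.gcd_dvd_right (ℓ ^ 2) n) h2

/-- `16 ∣ ℓ² − 1` for `ℓ ≡ ±1 (mod 8)`. [folklore] -/
theorem sixteen_dvd_sq_sub_one {ℓ : ℕ} (h : ℓ % 8 = 1 ∨ ℓ % 8 = 7) : (2 ^ 4 : ℤ) ∣ (ℓ : ℤ) ^ 2 - 1 := by
  have hℓ : (ℓ : ℤ) = 8 * (ℓ / 8 : ℕ) + (ℓ % 8 : ℕ) := by exact_mod_cast (Nat.div_add_mod ℓ 8).symm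
  rcases h with h | h
  · refine ⟨4 * (ℓ / 8 : ℕ) ^ 2 + (ℓ / 8 : ℕ), ?_⟩
    rw [hℓ, h]; push_cast; ring
  · refine ⟨4 * (ℓ / 8 : ℕ) ^ 2 + 7 * (ℓ / 8 : ℕ) + 3, ?_⟩
    rw [hℓ, h]; push_cast; ring

/-- **Local factors of `S(n)`, closed forms and `2`-adic sizes.** At a prime `ℓ ∣ N` (odd `N`, admissible `β`) the local
factor `F_ℓ(n) = ∑_{j ≤ v_ℓ(N)} c_ℓ(j)·gcd(ℓ^j, n)²/ℓ^j` is one of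
`(ℓ²−1)/ℓ²`, `0` (`ℓ ∥ N`, `β_ℓ = 1`; `ℓ ∤ n` resp. `ℓ ∣ n`), `(ℓ−1)/ℓ`, `1 − ℓ` (`ℓ ∥ N`, `β_ℓ = ℓ`),
`(ℓ−1)²(ℓ+1)/ℓ³`, `−(ℓ²−1)/ℓ`, `0` (`ℓ² ∥ N`; `ℓ ∤ n`, `ℓ ∥ n`, `ℓ² ∣ n`); hence `‖F_ℓ‖₂ ≤ 2⁻¹` always,
`≤ 2⁻³` if `β_ℓ = 1` or `ℓ² ∥ N`, and `≤ 2⁻⁴` if `ℓ² ∥ N` and `ℓ ≡ ±1 (mod 8)`. [cite: Stevens1982, §2.4 (PDF pp. 35–37)] -/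
theorem norm_cuspLocal_le (hodd : Odd N) (hadm : IsAdmissibleStabData N β) {ℓ : ℕ} (hℓ : ℓ ∈ N.primeFactors) (n : ℕ) :
    let F : ℚ := ∑ j ∈ Finset.range (N.factorization ℓ + 1),
        localStabCoeff N β ℓ j * ((((ℓ ^ j).gcd n : ℕ) : ℚ) ^ 2 / ((ℓ ^ j : ℕ) : ℚ))
    ‖((F : ℚ) : ℚ_[2])‖ ≤ (2 : ℝ) ^ (-(1 : ℤ)) ∧
      (N.factorization ℓ = 1 → β ℓ = 1 → ‖((F : ℚ) : ℚ_[2])‖ ≤ (2 : ℝ) ^ (-(3 : ℤ))) ∧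
      (N.factorization ℓ = 2 → ‖((F : ℚ) : ℚ_[2])‖ ≤ (2 : ℝ) ^ (-(3 : ℤ))) ∧
      (N.factorization ℓ = 2 → (ℓ % 8 = 1 ∨ ℓ % 8 = 7) → ‖((F : ℚ) : ℚ_[2])‖ ≤ (2 : ℝ) ^ (-(4 : ℤ))) := by
  intro F
  have hp : ℓ.Prime := Nat.prime_of_mem_primeFactors hℓ
  have hℓ0 : (ℓ : ℚ) ≠ 0 := by exact_mod_cast hp.ne_zero
  have hℓ1 := norm_natCast_eq_one_of_mem_primeFactors_odd hodd hℓ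
  obtain ⟨d1, d3, d4⟩ := dvd_of_odd_prime (odd_of_mem_primeFactors_odd hodd hℓ)
  have hpow : ∀ j : ℕ, ‖((ℓ : ℚ_[2])) ^ j‖ = 1 := fun j ↦ by rw [norm_pow, hℓ1, one_pow]
  -- gcd values
  have g1a : ¬ ℓ ∣ n → (ℓ ^ 1).gcd n = 1 := fun h ↦ by
    rw [pow_one]; exact Nat.Coprime.gcd_eq_one ((Nat.Prime.coprime_iff_not_dvd hp).mpr h)
  have g1b : ℓ ∣ n → (ℓ ^ 1).gcd n = ℓ := fun h ↦ by rw [pow_one]; exact Nat.gcd_eq_left h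
  have g2a : ¬ ℓ ∣ n → (ℓ ^ 2).gcd n = 1 := fun h ↦
    Nat.Coprime.gcd_eq_one (Nat.Coprime.pow_left 2 ((Nat.Prime.coprime_iff_not_dvd hp).mpr h))
  have g2c : ℓ ^ 2 ∣ n → (ℓ ^ 2).gcd n = ℓ ^ 2 := fun h ↦ Nat.gcd_eq_left h
  -- closed forms
  have hF1 : N.factorization ℓ = 1 →
      F = 1 - (β ℓ : ℚ) / ℓ * ((((ℓ ^ 1).gcd n : ℕ) : ℚ) ^ 2 / ℓ) := fun h1 ↦ by
    simp only [F, h1, Finset.sum_range_succ, Finset.sum_range_zero, localStabCoeff, if_true,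
      show (1 : ℕ) ≠ 0 from one_ne_zero, if_false, pow_zero, pow_one, Nat.gcd_one_left, Nat.cast_one]
    ring
  have hF2 : N.factorization ℓ = 2 →
      F = 1 - ((1 : ℚ) + ℓ) / ℓ * ((((ℓ ^ 1).gcd n : ℕ) : ℚ) ^ 2 / ℓ) +
        (1 : ℚ) / ℓ * ((((ℓ ^ 2).gcd n : ℕ) : ℚ) ^ 2 / (ℓ : ℚ) ^ 2) := fun h2 ↦ by
    simp only [F, h2, Finset.sum_range_succ, Finset.sum_range_zero, localStabCoeff, if_true,
      show (2 : ℕ) ≠ 1 from by decide, show (1 : ℕ) ≠ 0 from one_ne_zero, show (2 : ℕ) ≠ 0 from two_ne_zero,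
      if_false, pow_zero, pow_one, Nat.gcd_one_left, Nat.cast_one, Nat.cast_pow]
    ring
  -- the seven values and their norms
  have v11a : N.factorization ℓ = 1 → β ℓ = 1 → ¬ ℓ ∣ n → ‖((F : ℚ) : ℚ_[2])‖ ≤ (2 : ℝ) ^ (-(3 : ℤ)) :=
      fun h1 hb hn ↦ by
    have e : F = (((ℓ : ℤ) ^ 2 - 1 : ℤ) : ℚ) / (ℓ : ℚ) ^ 2 := by
      rw [hF1 h1, hb, g1a hn]; push_cast; field_simp
    rw [e]; push_cast
    have := norm_intCast_div_le_of_dvd d3 (hpow 2); push_cast at this; exact this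
  have v11b : N.factorization ℓ = 1 → β ℓ = 1 → ℓ ∣ n → F = 0 := fun h1 hb hn ↦ by
    rw [hF1 h1, hb, g1b hn]; field_simp; ring
  have v1ℓa : N.factorization ℓ = 1 → β ℓ = ℓ → ¬ ℓ ∣ n → ‖((F : ℚ) : ℚ_[2])‖ ≤ (2 : ℝ) ^ (-(1 : ℤ)) :=
      fun h1 hb hn ↦ by
    have e : F = (((ℓ : ℤ) - 1 : ℤ) : ℚ) / (ℓ : ℚ) := by
      rw [hF1 h1, hb, g1a hn]; push_cast; field_simp
    rw [e]; push_cast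
    have := norm_intCast_div_le_of_dvd d1 (u := (ℓ : ℚ_[2])) (by rw [hℓ1]); push_cast at this; exact this
  have v1ℓb : N.factorization ℓ = 1 → β ℓ = ℓ → ℓ ∣ n → ‖((F : ℚ) : ℚ_[2])‖ ≤ (2 : ℝ) ^ (-(1 : ℤ)) :=
      fun h1 hb hn ↦ by
    have e : F = ((-((ℓ : ℤ) - 1) : ℤ) : ℚ) / (1 : ℚ) := by
      rw [hF1 h1, hb, g1b hn]; push_cast; field_simp; ring
    rw [e]; push_cast
    have := norm_intCast_div_le_of_dvd ((dvd_neg).mpr d1) (u := (1 : ℚ_[2])) norm_one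
    push_cast at this; exact this
  have v2a : N.factorization ℓ = 2 → ¬ ℓ ∣ n → ‖((F : ℚ) : ℚ_[2])‖ ≤ (2 : ℝ) ^ (-(4 : ℤ)) := fun h2 hn ↦ by
    have e : F = ((((ℓ : ℤ) - 1) ^ 2 * ((ℓ : ℤ) + 1) : ℤ) : ℚ) / (ℓ : ℚ) ^ 3 := by
      rw [hF2 h2, g1a hn, g2a hn]; push_cast; field_simp; ring
    rw [e]; push_cast
    have := norm_intCast_div_le_of_dvd d4 (hpow 3); push_cast at this; exact this
  have v2b : N.factorization ℓ = 2 → ℓ ∣ n → ¬ ℓ ^ 2 ∣ n → F = ((-((ℓ : ℤ) ^ 2 - 1) : ℤ) : ℚ) / (ℓ : ℚ) :=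
      fun h2 hn hn2 ↦ by
    rw [hF2 h2, g1b hn, gcd_sq_eq_of_dvd_not_dvd hp hn hn2]; push_cast; field_simp; ring
  have v2b3 : N.factorization ℓ = 2 → ℓ ∣ n → ¬ ℓ ^ 2 ∣ n → ‖((F : ℚ) : ℚ_[2])‖ ≤ (2 : ℝ) ^ (-(3 : ℤ)) :=
      fun h2 hn hn2 ↦ by
    rw [v2b h2 hn hn2]; push_cast
    have := norm_intCast_div_le_of_dvd ((dvd_neg).mpr d3) (u := (ℓ : ℚ_[2])) (by rw [hℓ1])
    push_cast at this; exact this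
  have v2b4 : N.factorization ℓ = 2 → ℓ ∣ n → ¬ ℓ ^ 2 ∣ n → (ℓ % 8 = 1 ∨ ℓ % 8 = 7) →
      ‖((F : ℚ) : ℚ_[2])‖ ≤ (2 : ℝ) ^ (-(4 : ℤ)) := fun h2 hn hn2 h8 ↦ by
    rw [v2b h2 hn hn2]; push_cast
    have := norm_intCast_div_le_of_dvd ((dvd_neg).mpr (sixteen_dvd_sq_sub_one h8)) (u := (ℓ : ℚ_[2]))
      (by rw [hℓ1])
    push_cast at this; exact this
  have v2c : N.factorization ℓ = 2 → ℓ ^ 2 ∣ n → F = 0 := fun h2 hn2 ↦ by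
    rw [hF2 h2, g1b (dvd_trans (dvd_pow_self ℓ two_ne_zero) hn2), g2c hn2]; push_cast; field_simp; ring
  -- assemble
  have n0 : ∀ k : ℤ, F = 0 → ‖((F : ℚ) : ℚ_[2])‖ ≤ (2 : ℝ) ^ k := fun k h ↦ by
    rw [h, Rat.cast_zero, norm_zero]; positivity
  have c2 : N.factorization ℓ = 2 → ‖((F : ℚ) : ℚ_[2])‖ ≤ (2 : ℝ) ^ (-(3 : ℤ)) := fun h2 ↦ by
    by_cases hn : ℓ ∣ n
    · by_cases hn2 : ℓ ^ 2 ∣ n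
      · exact n0 _ (v2c h2 hn2)
      · exact v2b3 h2 hn hn2
    · exact (v2a h2 hn).trans (by norm_num)
  refine ⟨?_, fun h1 hb ↦ ?_, c2, fun h2 h8 ↦ ?_⟩
  · rcases factorization_eq_one_or_two_of_admissible hadm hℓ with h1 | h2
    · rcases hadm.2.1 ℓ hℓ h1 with hb | hb
      · by_cases hn : ℓ ∣ n
        · exact n0 _ (v11b h1 hb hn)
        · exact (v11a h1 hb hn).trans (by norm_num)
      · by_cases hn : ℓ ∣ n
        · exact v1ℓb h1 hb hn
        · exact v1ℓa h1 hb hn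
    · exact (c2 h2).trans (by norm_num)
  · by_cases hn : ℓ ∣ n
    · exact n0 _ (v11b h1 hb hn)
    · exact v11a h1 hb hn
  · by_cases hn : ℓ ∣ n
    · by_cases hn2 : ℓ ^ 2 ∣ n
      · exact n0 _ (v2c h2 hn2)
      · exact v2b4 h2 hn hn2 h8
    · exact v2a h2 hn


/-- **(E-LEG) `S(n) ≡ 0 (mod 16)` in `ℤ₂ off the exceptional levels.** For odd `N`, admissible `β`, and `N` not of the form
`ℓ²` with `ℓ ≡ ±3 (mod 8)`: `‖∑_{t ∣ N} c_t·gcd(t, n)²/t‖₂ ≤ 2⁻⁴` for EVERY `n` (one depleted prime gives `2³` at worst and a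
second prime factor another `2`; a lone depleted prime `ℓ ≡ ±1 (8)` gives `2⁴`; in the squarefree case the `β_ℓ = ℓ` prime gives
`2` and the `β_ℓ = 1` prime `2³`). At `N = ℓ²`, `ℓ ≡ ±3 (8)`, `n = ℓ`: `S = −(ℓ²−1)/ℓ` has norm exactly `2⁻³` (sharp; kit job
j312110: the odd cusp classes for odd cube-free `N ≤ 1501` occur exactly at `N ∈ {9, 25, 121, 169, 361, 841, 1369}`).
[cite: Stevens1982, §2.4–2.5 (PDF pp. 35–38)] -/
theorem norm_cuspSum_le (hN : N ≠ 0) (hodd : Odd N) (hadm : IsAdmissibleStabData N β)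
    (hexc : ∀ ℓ : ℕ, ℓ.Prime → N = ℓ ^ 2 → ℓ % 8 = 1 ∨ ℓ % 8 = 7) (n : ℕ) :
    ‖((∑ t ∈ N.divisors, stabCoeff N β t * ((t.gcd n : ℕ) : ℚ) ^ 2 / t : ℚ) : ℚ_[2])‖ ≤ (2 : ℝ) ^ (-(4 : ℤ)) := by
  rw [cuspSum_eq_prod hN n, Rat.cast_prod, norm_prod]
  set F : ℕ → ℝ := fun ℓ ↦ ‖((∑ j ∈ Finset.range (N.factorization ℓ + 1),
    localStabCoeff N β ℓ j * ((((ℓ ^ j).gcd n : ℕ) : ℚ) ^ 2 / ((ℓ ^ j : ℕ) : ℚ)) : ℚ) : ℚ_[2])‖ with hF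
  show ∏ ℓ ∈ N.primeFactors, F ℓ ≤ (2 : ℝ) ^ (-(4 : ℤ))
  have hle1 : ∀ ℓ ∈ N.primeFactors, F ℓ ≤ 1 := fun ℓ hℓ ↦
    (norm_cuspLocal_le hodd hadm hℓ n).1.trans (by norm_num)
  have hnn : ∀ ℓ ∈ N.primeFactors, 0 ≤ F ℓ := fun ℓ _ ↦ norm_nonneg _
  -- two distinct primes with local sizes `2⁻¹` and `2⁻³` suffice
  have two : ∀ {ℓ₁ ℓ₂ : ℕ}, ℓ₁ ∈ N.primeFactors → ℓ₂ ∈ N.primeFactors → ℓ₂ ≠ ℓ₁ →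
      F ℓ₁ ≤ (2 : ℝ) ^ (-(1 : ℤ)) → F ℓ₂ ≤ (2 : ℝ) ^ (-(3 : ℤ)) →
      ∏ ℓ ∈ N.primeFactors, F ℓ ≤ (2 : ℝ) ^ (-(4 : ℤ)) := by
    intro ℓ₁ ℓ₂ hℓ₁ hℓ₂ hne b₁ b₂
    have hℓ₂' : ℓ₂ ∈ N.primeFactors.erase ℓ₁ := Finset.mem_erase.mpr ⟨hne, hℓ₂⟩
    rw [← Finset.mul_prod_erase _ _ hℓ₁, ← Finset.mul_prod_erase _ _ hℓ₂']
    have hrest : ∏ ℓ ∈ (N.primeFactors.erase ℓ₁).erase ℓ₂, F ℓ ≤ 1 :=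
      Finset.prod_le_one (fun ℓ hℓ ↦ hnn ℓ (Finset.mem_of_mem_erase (Finset.mem_of_mem_erase hℓ)))
        fun ℓ hℓ ↦ hle1 ℓ (Finset.mem_of_mem_erase (Finset.mem_of_mem_erase hℓ))
    have hrest0 : 0 ≤ ∏ ℓ ∈ (N.primeFactors.erase ℓ₁).erase ℓ₂, F ℓ :=
      Finset.prod_nonneg fun ℓ hℓ ↦ hnn ℓ (Finset.mem_of_mem_erase (Finset.mem_of_mem_erase hℓ))
    calc F ℓ₁ * (F ℓ₂ * ∏ ℓ ∈ (N.primeFactors.erase ℓ₁).erase ℓ₂, F ℓ)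
        ≤ 2 ^ (-(1 : ℤ)) * (2 ^ (-(3 : ℤ)) * 1) := by
          refine mul_le_mul b₁ (mul_le_mul b₂ hrest hrest0 (by positivity)) (mul_nonneg (hnn ℓ₂ hℓ₂) hrest0)
            (by positivity)
      _ = 2 ^ (-(4 : ℤ)) := by norm_num
  by_cases hA : ∃ ℓ₀ ∈ N.primeFactors, N.factorization ℓ₀ = 2
  · obtain ⟨ℓ₀, hℓ₀, h2⟩ := hA
    by_cases hB : ∃ ℓ' ∈ N.primeFactors, ℓ' ≠ ℓ₀
    · obtain ⟨ℓ', hℓ', hne⟩ := hB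
      exact two hℓ' hℓ₀ hne.symm (norm_cuspLocal_le hodd hadm hℓ' n).1
        ((norm_cuspLocal_le hodd hadm hℓ₀ n).2.2.1 h2)
    · -- a lone depleted prime: `N = ℓ₀²`, not exceptional by hypothesis
      push Not at hB
      have hpf : N.primeFactors = {ℓ₀} :=
        Finset.eq_singleton_iff_unique_mem.mpr ⟨hℓ₀, fun ℓ hℓ ↦ hB ℓ hℓ⟩
      have hfac : N.factorization = Finsupp.single ℓ₀ 2 := by
        ext q
        by_cases hq : q = ℓ₀
        · subst hq; rw [Finsupp.single_eq_same, h2]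
        · rw [Finsupp.single_apply, if_neg (Ne.symm hq)]
          have hq' : q ∉ N.factorization.support := by
            rw [Nat.support_factorization, hpf, Finset.mem_singleton]; exact hq
          exact Finsupp.notMem_support_iff.mp hq'
      have hNeq : N = ℓ₀ ^ 2 := Nat.eq_pow_of_factorization_eq_single hN hfac
      have h8 := hexc ℓ₀ (Nat.prime_of_mem_primeFactors hℓ₀) hNeq
      rw [hpf, Finset.prod_singleton]
      exact (norm_cuspLocal_le hodd hadm hℓ₀ n).2.2.2 h2 h8
  · -- squarefree level: the `β_ℓ = ℓ` prime and the `β_ℓ = 1` prime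
    push Not at hA
    have hall : ∀ ℓ ∈ N.primeFactors, N.factorization ℓ = 1 := fun ℓ hℓ ↦
      (factorization_eq_one_or_two_of_admissible hadm hℓ).resolve_right (hA ℓ hℓ)
    rcases hadm.2.2 with ⟨ℓ₀, hℓ₀, h2⟩ | ⟨⟨ℓ₁, hℓ₁, hb₁⟩, ⟨ℓ₂, hℓ₂, hb₂⟩⟩
    · exact absurd h2 (hA ℓ₀ hℓ₀)
    · have hne : ℓ₂ ≠ ℓ₁ := by
        rintro rfl
        rw [hb₂] at hb₁
        exact (Nat.prime_of_mem_primeFactors hℓ₁).one_lt.ne hb₁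
      exact two hℓ₁ hℓ₂ hne (norm_cuspLocal_le hodd hadm hℓ₁ n).1
        ((norm_cuspLocal_le hodd hadm hℓ₂ n).2.1 (hall ℓ₂ hℓ₂) hb₂)

end ELeg


/-! ### §4 Parabolic normal form: a trace-`2` element of `SL(2, ℤ)` is `σ T^h σ⁻¹` -/

/-- **Parabolic normal form.** Every `γ ∈ SL(2, ℤ)` of trace `2` is `σ T^h σ⁻¹` for some `σ ∈ SL(2, ℤ)`, `h ∈ ℤ`
(complete a primitive fixed vector of `γ` to a basis). [cite: Shimura1971, §1.3 (parabolic elements)] -/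
theorem exists_eq_conj_T_zpow_of_trace_eq_two (γ : SL(2, ℤ)) (htr : (γ : Matrix (Fin 2) (Fin 2) ℤ).trace = 2) :
    ∃ σ : SL(2, ℤ), ∃ h : ℤ, γ = σ * ModularGroup.T ^ h * σ⁻¹ := by
  have hdet : γ 0 0 * γ 1 1 - γ 0 1 * γ 1 0 = 1 := by
    have := Matrix.SpecialLinearGroup.det_coe γ
    rwa [Matrix.det_fin_two] at this
  rw [Matrix.trace_fin_two] at htr
  -- a nonzero fixed vector `(x, y)` of `γ`
  obtain ⟨x, y, hne, hx, hy⟩ : ∃ x y : ℤ, (x ≠ 0 ∨ y ≠ 0) ∧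
      γ 0 0 * x + γ 0 1 * y = x ∧ γ 1 0 * x + γ 1 1 * y = y := by
    by_cases h0 : γ 0 1 = 0 ∧ γ 0 0 = 1
    · refine ⟨0, 1, Or.inr one_ne_zero, by rw [h0.1]; ring, ?_⟩
      have h11 : γ 1 1 = 1 := by linarith [h0.2]
      rw [h11]; ring
    · refine ⟨γ 0 1, 1 - γ 0 0, ?_, by ring, by linear_combination (-1 : ℤ) * hdet + htr⟩
      rcases not_and_or.mp h0 with h1 | h1
      · exact Or.inl h1
      · exact Or.inr (sub_ne_zero.mpr (Ne.symm h1))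
  -- its primitive part `(a, c)`
  have hg : 0 < Int.gcd x y := by
    rcases hne with h | h
    · exact Int.gcd_pos_of_ne_zero_left _ h
    · exact Int.gcd_pos_of_ne_zero_right _ h
  obtain ⟨a, c, hcop, hxa, hyc⟩ := Int.exists_gcd_one hg
  set G : ℕ := Int.gcd x y with hG
  clear_value G
  subst hxa hyc
  have hg0 : (G : ℤ) ≠ 0 := by exact_mod_cast hg.ne'
  have ha : γ 0 0 * a + γ 0 1 * c = a := by
    have h1 : (γ 0 0 * a + γ 0 1 * c - a) * (G : ℤ) = 0 := by linear_combination hx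
    exact sub_eq_zero.mp ((mul_eq_zero.mp h1).resolve_right hg0)
  have hc : γ 1 0 * a + γ 1 1 * c = c := by
    have h1 : (γ 1 0 * a + γ 1 1 * c - c) * (G : ℤ) = 0 := by linear_combination hy
    exact sub_eq_zero.mp ((mul_eq_zero.mp h1).resolve_right hg0)
  -- complete `(a, c)` to `σ ∈ SL(2, ℤ)`
  have hbez : a * Int.gcdA a c + c * Int.gcdB a c = 1 := by
    have := Int.gcd_eq_gcd_ab a c; rw [hcop] at this; push_cast at this; linear_combination -this
  let σ : SL(2, ℤ) := ⟨!![a, -Int.gcdB a c; c, Int.gcdA a c], by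
    rw [Matrix.det_fin_two_of]; linear_combination hbez⟩
  have s00 : σ 0 0 = a := rfl
  have s01 : σ 0 1 = -Int.gcdB a c := rfl
  have s10 : σ 1 0 = c := rfl
  have s11 : σ 1 1 = Int.gcdA a c := rfl
  have i00 : (σ⁻¹ : SL(2, ℤ)) 0 0 = Int.gcdA a c := by
    simp [Matrix.SpecialLinearGroup.coe_inv, Matrix.adjugate_fin_two, s11]
  have i01 : (σ⁻¹ : SL(2, ℤ)) 0 1 = Int.gcdB a c := by
    simp [Matrix.SpecialLinearGroup.coe_inv, Matrix.adjugate_fin_two, s01]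
  have i10 : (σ⁻¹ : SL(2, ℤ)) 1 0 = -c := by
    simp [Matrix.SpecialLinearGroup.coe_inv, Matrix.adjugate_fin_two, s10]
  have i11 : (σ⁻¹ : SL(2, ℤ)) 1 1 = a := by
    simp [Matrix.SpecialLinearGroup.coe_inv, Matrix.adjugate_fin_two, s00]
  -- `M := σ⁻¹ γ σ` fixes `e₁`, hence is `T^h`
  set M : SL(2, ℤ) := σ⁻¹ * γ * σ with hM
  have mul3 : ∀ i j : Fin 2, M i j = (σ⁻¹ : SL(2, ℤ)) i 0 * (γ 0 0 * σ 0 j + γ 0 1 * σ 1 j) +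
      (σ⁻¹ : SL(2, ℤ)) i 1 * (γ 1 0 * σ 0 j + γ 1 1 * σ 1 j) := by
    intro i j
    change ((σ⁻¹ : SL(2, ℤ)) * γ * σ : SL(2, ℤ)) i j = _
    simp [Matrix.SpecialLinearGroup.coe_mul, Matrix.mul_apply, Fin.sum_univ_two]
    ring
  have m00 : M 0 0 = 1 := by
    rw [mul3, i00, i01, s00, s10]; linear_combination Int.gcdA a c * ha + Int.gcdB a c * hc + hbez
  have m10 : M 1 0 = 0 := by
    rw [mul3, i10, i11, s00, s10]; linear_combination (-c) * ha + a * hc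
  have m11 : M 1 1 = 1 := by
    have := Matrix.SpecialLinearGroup.det_coe M
    rw [Matrix.det_fin_two] at this
    have e : M 0 0 * M 1 1 - M 0 1 * M 1 0 = 1 := this
    rw [m00, m10] at e; linarith
  have hMT : M = ModularGroup.T ^ (M 0 1) := by
    refine Matrix.SpecialLinearGroup.ext _ _ fun i j ↦ ?_
    have e : ((ModularGroup.T ^ (M 0 1) : SL(2, ℤ)) : Matrix (Fin 2) (Fin 2) ℤ) = !![1, M 0 1; 0, 1] :=
      ModularGroup.coe_T_zpow _
    fin_cases i <;> fin_cases j
    · rw [e]; exact m00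
    · rw [e]; rfl
    · rw [e]; exact m10
    · rw [e]; exact m11
  refine ⟨σ, M 0 1, ?_⟩
  rw [← hMT, hM]; group

end Summit.BirchSwinnertonDyer.BirchSwinnertonDyer.Theorems.DepletionAtTwo.CuspEvenness
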